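import Summits.Ventures.Crystal3D.Theorems.StickyWulffConstantGenericWallFloorStarPairLocalAtlasA
import Summits.Ventures.Crystal3D.Theorems.StickyWulffConstantGenericWallFloorStarPairLocalAtlasB
import Summits.Ventures.Crystal3D.Theorems.StickyWulffConstantGenericWallFloorStarPairLocalAtlasC
import Summits.Ventures.Crystal3D.Theorems.StickyWulffConstantGenericWallFloorDoubleStarOfFar
import Summits.Ventures.Crystal3D.Theorems.StickyWulffConstantGenericWallFloorStarPairCoaxial
import HarnessLib

/-!
# `StarPairCoaxial` from ONE certified computation: the named hypothesis `StarPairFar`, the star atlas dispatch,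
# the normal form, and the reduction (crux `GenericWallFloor`, line `WallLedgerG`)

HONEST FRAMING. Part of the venture `Summits/Ventures/Crystal3D` (cell `crystal3d-full`), helper
`--supports` the crux `GenericWallFloor` (stmt-Ventures-19480) of `route-Ventures-StickyWulffConstant`,
registered line `WallLedgerG`, open stub `stub_twoSlabAdhesion` (general fillings).  The localised stack ledger
(19480-p2 g3) prices coincident walk ends through `DoubleStarCoaxialAt` (R39d) and `CapPairCoaxial` (R39e); both are
consequences of the stars-only input `StarPairCoaxial` (`…StarPairCoaxial`: `capPairCoaxial_of_starPair`,
`doubleStarCoaxialAt_of_starPair`).  This file reduces `StarPairCoaxial` to ONE named computational hypothesis, exactly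
as wulff-p2's `…DoubleTopFar` / `…DoubleStarOfFar` did for R39d:

* `starDtCerts` — the 46 star-supported local certificates (`…StarPairLocalData1–5`, lit g13's exact LP);
  `coaxial_of_inStarCertBall` — inside any of their balls the STAR hypotheses force co-axiality (atlas
  `…StarPairLocalAtlasA/B/C`);
* **`StarPairFar`** (NOT proved here; CERTIFIED COMPUTATION, lit g13 kit j298152–j298155, exact-rational interval
  branch and bound, 2048/2048 tasks, FAIL list empty, 222 280 q-boxes / 9 130 534 y-boxes; HOME/cf-lit/r41e/star/,
  evidence STAR-* on the item): for every linear isometry `R` and point `y`, if the five star balls `wPt i`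
  (`i ∈ starIdx`) and their `R`-images are `1`-separated up to coincidence, `y` is a unit vector at distance `≥ 1`
  from these ten balls, and `(R, y)` as well as `(R ∘ μ, y)` (`μ = swapMirror`, which maps the star onto itself) lie
  OUTSIDE all 46 star certificate balls, then `False`;
* `coaxial_of_starPairNF` — `StarPairFar` ⇒ the normal-form statement (R39d case split: ball of `R` ⇒ atlas; ball
  of `R ∘ μ` ⇒ atlas and `(R ∘ μ)·Λ₀ = R·Λ₀`; else `StarPairFar`);
* **`starPairCoaxial_of_far : StarPairFar → StarPairCoaxial`** — slot transitivity (`exists_latticeIso_map_slot`)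
  normalises `v₁ = v₂ = slotSite 0`; the affine isometry `x ↦ e + F₁g₁x` carries the star `wPt i`, `i ∈ starIdx`, onto
  the owned star of grain 1 and `R·wPt`, `R = (F₁g₁)⁻¹F₂g₂`, onto that of grain 2; the eleventh contact is off the ten
  star balls by hypothesis; `coaxial_of_starPairNF` + `coaxial_of_common_frame`.
Hence `StarPairFar` ⇒ `StarPairCoaxial` ⇒ R39d ∧ R39e: the two double-end inputs of the residual-free non-chain stack
ledger are ONE certified computation.

WHAT THIS IS NOT: `StarPairFar` is NOT proved in the kernel (certified computation, one lineage: lit g13, exact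
rationals); not the stub; F-C1 not moved.
-/

noncomputable section

namespace Summit.Ventures.Crystal3D.Theorems

open Matrix NearIdentity Finset
open Literature.MathematicalPhysics.StatisticalMechanics (fccStacking barlowStacking IsHaggSeq)
open scoped InnerProductSpace

/-! ### The star certificate list and the atlas dispatch -/

/-- The 46 star-supported local rigidity certificates of `…StarPairLocalData1–5`. -/
def starDtCerts : List DTCert :=
  [star_b0, star_b1, star_b2, star_b3_m1p1p0, star_b3_p1m1p0, star_b4,
    star_b5, star_b6, star_b7, star_b8, star_b9, star_b10,
    star_b11_m1p1p0, star_b11_p1m1p0, star_b12, star_b13, star_b14, star_b15,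
    star_b16, star_b17, star_b18, star_b19, star_b20, star_b21,
    star_b22, star_b23, star_b27, star_b31_p1p0m1, star_b31_p1m1p0, star_b35,
    star_b38_p1p0m1, star_b38_p1m1p0, star_b41_p0p1m1, star_b41_m1p1p0, star_b47_p0p1m1, star_b47_m1p1p0,
    star_b51, star_b54_p1p0p1, star_b54_p1m1p0, star_b59, star_b63_p1p0p1, star_b63_p1m1p0,
    star_b67_p0p1p1, star_b67_m1p1p0, star_b69_p0p1p1, star_b69_m1p1p0]

/-- **Star atlas dispatch**: inside the ball of any listed star certificate the STAR hypotheses force co-axiality. -/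
theorem coaxial_of_inStarCertBall (R : EuclideanSpace ℝ (Fin 3) ≃ₗᵢ[ℝ] EuclideanSpace ℝ (Fin 3))
    (y : EuclideanSpace ℝ (Fin 3))
    (hclus : ∀ i ∈ starIdx, ∀ j ∈ starIdx, wPt i = R (wPt j) ∨ 1 ≤ dist (wPt i) (R (wPt j)))
    (hy : ‖y‖ = 1) (hyF : ∀ i ∈ starIdx, 1 ≤ dist y (wPt i)) (hyM : ∀ j ∈ starIdx, 1 ≤ dist y (R (wPt j)))
    {c : DTCert} (hc : c ∈ starDtCerts) (hb : InCertBall R y c) :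
    ∃ L : EuclideanSpace ℝ (Fin 3) ≃ₗᵢ[ℝ] EuclideanSpace ℝ (Fin 3),
      (fccStacking 1 (Real.sqrt (2 / 3)) = L '' fccStacking 1 (Real.sqrt (2 / 3)) ∨
        fccStacking 1 (Real.sqrt (2 / 3)) = L '' barlowStacking 1 (Real.sqrt (2 / 3)) (fun _ : ℤ => (-1 : ℤ))) ∧
      (R '' fccStacking 1 (Real.sqrt (2 / 3)) = L '' fccStacking 1 (Real.sqrt (2 / 3)) ∨
        R '' fccStacking 1 (Real.sqrt (2 / 3)) = L '' barlowStacking 1 (Real.sqrt (2 / 3)) (fun _ : ℤ => (-1 : ℤ))) := by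
  unfold InCertBall at hb
  simp only [starDtCerts, List.mem_cons, List.mem_nil_iff, or_false] at hc
  rcases hc with rfl | rfl | rfl | rfl | rfl | rfl | rfl | rfl | rfl | rfl | rfl | rfl | rfl | rfl | rfl | rfl | rfl | rfl | rfl | rfl | rfl | rfl | rfl | rfl | rfl | rfl | rfl | rfl | rfl | rfl | rfl | rfl | rfl | rfl | rfl | rfl | rfl | rfl | rfl | rfl | rfl | rfl | rfl | rfl | rfl | rfl
  · exact star_b0_coaxial R y hclus hy hyF hyM hb
  · exact star_b1_coaxial R y hclus hy hyF hyM hb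
  · exact star_b2_coaxial R y hclus hy hyF hyM hb
  · exact star_b3_m1p1p0_coaxial R y hclus hy hyF hyM hb
  · exact star_b3_p1m1p0_coaxial R y hclus hy hyF hyM hb
  · exact star_b4_coaxial R y hclus hy hyF hyM hb
  · exact star_b5_coaxial R y hclus hy hyF hyM hb
  · exact star_b6_coaxial R y hclus hy hyF hyM hb
  · exact star_b7_coaxial R y hclus hy hyF hyM hb
  · exact star_b8_coaxial R y hclus hy hyF hyM hb
  · exact star_b9_coaxial R y hclus hy hyF hyM hb
  · exact star_b10_coaxial R y hclus hy hyF hyM hb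
  · exact star_b11_m1p1p0_coaxial R y hclus hy hyF hyM hb
  · exact star_b11_p1m1p0_coaxial R y hclus hy hyF hyM hb
  · exact star_b12_coaxial R y hclus hy hyF hyM hb
  · exact star_b13_coaxial R y hclus hy hyF hyM hb
  · exact star_b14_coaxial R y hclus hy hyF hyM hb
  · exact star_b15_coaxial R y hclus hy hyF hyM hb
  · exact star_b16_coaxial R y hclus hy hyF hyM hb
  · exact star_b17_coaxial R y hclus hy hyF hyM hb
  · exact star_b18_coaxial R y hclus hy hyF hyM hb
  · exact star_b19_coaxial R y hclus hy hyF hyM hb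
  · exact star_b20_coaxial R y hclus hy hyF hyM hb
  · exact star_b21_coaxial R y hclus hy hyF hyM hb
  · exact star_b22_coaxial R y hclus hy hyF hyM hb
  · exact star_b23_coaxial R y hclus hy hyF hyM hb
  · exact star_b27_coaxial R y hclus hy hyF hyM hb
  · exact star_b31_p1p0m1_coaxial R y hclus hy hyF hyM hb
  · exact star_b31_p1m1p0_coaxial R y hclus hy hyF hyM hb
  · exact star_b35_coaxial R y hclus hy hyF hyM hb
  · exact star_b38_p1p0m1_coaxial R y hclus hy hyF hyM hb
  · exact star_b38_p1m1p0_coaxial R y hclus hy hyF hyM hb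
  · exact star_b41_p0p1m1_coaxial R y hclus hy hyF hyM hb
  · exact star_b41_m1p1p0_coaxial R y hclus hy hyF hyM hb
  · exact star_b47_p0p1m1_coaxial R y hclus hy hyF hyM hb
  · exact star_b47_m1p1p0_coaxial R y hclus hy hyF hyM hb
  · exact star_b51_coaxial R y hclus hy hyF hyM hb
  · exact star_b54_p1p0p1_coaxial R y hclus hy hyF hyM hb
  · exact star_b54_p1m1p0_coaxial R y hclus hy hyF hyM hb
  · exact star_b59_coaxial R y hclus hy hyF hyM hb
  · exact star_b63_p1p0p1_coaxial R y hclus hy hyF hyM hb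
  · exact star_b63_p1m1p0_coaxial R y hclus hy hyF hyM hb
  · exact star_b67_p0p1p1_coaxial R y hclus hy hyF hyM hb
  · exact star_b67_m1p1p0_coaxial R y hclus hy hyF hyM hb
  · exact star_b69_p0p1p1_coaxial R y hclus hy hyF hyM hb
  · exact star_b69_m1p1p0_coaxial R y hclus hy hyF hyM hb

/-- The bond mirror `μ = swapMirror` maps the star onto itself. -/
theorem swapPerm_mem_starIdx : ∀ j ∈ starIdx, swapPerm j ∈ starIdx := by decide

/-! ### The named computational hypothesis and the normal form -/

/-- **`StarPairFar` (global half of the stars-only certificate; CERTIFIED COMPUTATION, lit g13 kit j298152–5;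
NOT proved here).**  For every linear isometry `R` and point `y`: if the five star balls and their `R`-images are
`1`-separated up to coincidence, `y` is a unit vector at distance `≥ 1` from the ten star balls, and `(R, y)` as well as
`(μ ≫ R, y)` lie OUTSIDE every star certificate ball of `starDtCerts`, then `False`. -/
def StarPairFar : Prop :=
  ∀ (R : EuclideanSpace ℝ (Fin 3) ≃ₗᵢ[ℝ] EuclideanSpace ℝ (Fin 3)) (y : EuclideanSpace ℝ (Fin 3)),
    (∀ i ∈ starIdx, ∀ j ∈ starIdx, wPt i = R (wPt j) ∨ 1 ≤ dist (wPt i) (R (wPt j))) →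
    ‖y‖ = 1 → (∀ i ∈ starIdx, 1 ≤ dist y (wPt i)) → (∀ j ∈ starIdx, 1 ≤ dist y (R (wPt j))) →
    (∀ c ∈ starDtCerts, ¬ InCertBall R y c) → (∀ c ∈ starDtCerts, ¬ InCertBall (swapMirror.trans R) y c) → False

/-- **Stars-only double star, normal form.**  Under `StarPairFar`: the star of `−slotSite 0` and its `R`-image
`1`-separated up to coincidence and an eleventh unit ball `y` clear of the ten star balls force `(Λ₀, R·Λ₀)` to be
co-axial. -/
theorem coaxial_of_starPairNF (hfar : StarPairFar)
    (R : EuclideanSpace ℝ (Fin 3) ≃ₗᵢ[ℝ] EuclideanSpace ℝ (Fin 3)) (y : EuclideanSpace ℝ (Fin 3))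
    (hclus : ∀ i ∈ starIdx, ∀ j ∈ starIdx, wPt i = R (wPt j) ∨ 1 ≤ dist (wPt i) (R (wPt j)))
    (hy : ‖y‖ = 1) (hyF : ∀ i ∈ starIdx, 1 ≤ dist y (wPt i)) (hyM : ∀ j ∈ starIdx, 1 ≤ dist y (R (wPt j))) :
    ∃ L : EuclideanSpace ℝ (Fin 3) ≃ₗᵢ[ℝ] EuclideanSpace ℝ (Fin 3),
      (fccStacking 1 (Real.sqrt (2 / 3)) = L '' fccStacking 1 (Real.sqrt (2 / 3)) ∨
        fccStacking 1 (Real.sqrt (2 / 3)) = L '' barlowStacking 1 (Real.sqrt (2 / 3)) (fun _ : ℤ => (-1 : ℤ))) ∧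
      (R '' fccStacking 1 (Real.sqrt (2 / 3)) = L '' fccStacking 1 (Real.sqrt (2 / 3)) ∨
        R '' fccStacking 1 (Real.sqrt (2 / 3)) = L '' barlowStacking 1 (Real.sqrt (2 / 3)) (fun _ : ℤ => (-1 : ℤ))) := by
  classical
  by_cases h1 : ∃ c ∈ starDtCerts, InCertBall R y c
  · obtain ⟨c, hc, hb⟩ := h1
    exact coaxial_of_inStarCertBall R y hclus hy hyF hyM hc hb
  set R' := swapMirror.trans R with hR'
  have hR'app : ∀ x, R' x = R (swapMirror x) := fun x => rfl
  by_cases h2 : ∃ c ∈ starDtCerts, InCertBall R' y c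
  · obtain ⟨c, hc, hb⟩ := h2
    have hclus' : ∀ i ∈ starIdx, ∀ j ∈ starIdx, wPt i = R' (wPt j) ∨ 1 ≤ dist (wPt i) (R' (wPt j)) := by
      intro i hi j hj; rw [hR'app, swapMirror_wPt]; exact hclus i hi _ (swapPerm_mem_starIdx j hj)
    have hyM' : ∀ j ∈ starIdx, 1 ≤ dist y (R' (wPt j)) := by
      intro j hj; rw [hR'app, swapMirror_wPt]; exact hyM _ (swapPerm_mem_starIdx j hj)
    obtain ⟨L, hL1, hL2⟩ := coaxial_of_inStarCertBall R' y hclus' hy hyF hyM' hc hb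
    have himg : R' '' fccStacking 1 (Real.sqrt (2 / 3)) = R '' fccStacking 1 (Real.sqrt (2 / 3)) := by
      rw [hR', LinearIsometryEquiv.coe_trans, Set.image_comp, swapMirror_image_fcc]
    exact ⟨L, hL1, by rw [← himg]; exact hL2⟩
  · push Not at h1 h2
    exact (hfar R y hclus hy hyF hyM h1 h2).elim

/-! ### The star balls of the walk cluster -/

/-- The star balls are non-centre balls of the cluster. -/
theorem clusterQ_ne_zero_of_mem_starIdx : ∀ i ∈ starIdx, clusterQ i ≠ 0 := by decide

/-- The star balls are unit vectors (contacts of the top). -/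
theorem norm_wPt_of_mem_starIdx {i : Fin 13} (hi : i ∈ starIdx) : ‖wPt i‖ = 1 := by
  have h2 := two_mul_norm_sq_wPt i
  rw [(mem_starIdx_iff_norm i).1 hi] at h2
  push_cast at h2
  have h1 : ‖wPt i‖ ^ 2 = 1 := by linarith
  have h0 : 0 ≤ ‖wPt i‖ := norm_nonneg _
  nlinarith [h1, h0]

/-- The star balls lie strictly below the equator of the walk slot: `⟪wPt i, slotSite 0⟫ < 0`. -/
theorem inner_wPt_slot_neg {i : Fin 13} (hi : i ∈ starIdx) : ⟪wPt i, slotSite 0⟫_ℝ < 0 := by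
  have h := two_mul_inner_wPt_slot i
  have hlt : ((dotQ (clusterQ i) (slotQ 0) : ℚ) : ℝ) < 0 := by
    exact_mod_cast clusterInt_slot_facts i (clusterQ_ne_zero_of_mem_starIdx i hi)
  linarith

/-! ### The reduction -/

/-- **`StarPairCoaxial` from `StarPairFar`.**  See the module docstring. -/
theorem starPairCoaxial_of_far (hfar : StarPairFar) : StarPairCoaxial := by
  classical
  intro F₁ F₂ v₁ hv₁ v₂ hv₂ X hX e _he hown₁ hown₂ y' hy'X hy'd hoff₁ hoff₂
  -- slot normalisation
  obtain ⟨g₁, hg₁, hg₁', hg₁s⟩ := exists_latticeIso_map_slot (slotSite_mem 0) hv₁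
  obtain ⟨g₂, hg₂, hg₂', hg₂s⟩ := exists_latticeIso_map_slot (slotSite_mem 0) hv₂
  set B₁ := g₁.trans F₁ with hB₁
  set B₂ := g₂.trans F₂ with hB₂
  set R := B₂.trans B₁.symm with hR
  have hRapp : ∀ x, B₁ (R x) = B₂ x := fun x => by simp [hR]
  -- the two stars
  set P : Fin 13 → EuclideanSpace ℝ (Fin 3) := fun i => e + B₁ (wPt i) with hP
  set Q : Fin 13 → EuclideanSpace ℝ (Fin 3) := fun j => e + B₂ (wPt j) with hQ
  have hslot : ∀ (g : EuclideanSpace ℝ (Fin 3) ≃ₗᵢ[ℝ] EuclideanSpace ℝ (Fin 3)) (u : EuclideanSpace ℝ (Fin 3)),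
      (∀ p ∈ fccStacking 1 (Real.sqrt (2 / 3)), g p ∈ fccStacking 1 (Real.sqrt (2 / 3))) → g (slotSite 0) = u →
      ∀ i ∈ starIdx, g (wPt i) ∈ fccSlots ∧ ⟪g (wPt i), u⟫_ℝ < 0 := by
    intro g u hg hgs i hi
    refine ⟨mem_fccSlots_of_unit (hg _ (wPt_mem_fcc i)) (by rw [LinearIsometryEquiv.norm_map, norm_wPt_of_mem_starIdx hi]),
      ?_⟩
    rw [← hgs, LinearIsometryEquiv.inner_map_map]; exact inner_wPt_slot_neg hi
  have hown : ∀ (g : EuclideanSpace ℝ (Fin 3) ≃ₗᵢ[ℝ] EuclideanSpace ℝ (Fin 3))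
      (A : EuclideanSpace ℝ (Fin 3) ≃ₗᵢ[ℝ] EuclideanSpace ℝ (Fin 3)) (u : EuclideanSpace ℝ (Fin 3)),
      (∀ p ∈ fccStacking 1 (Real.sqrt (2 / 3)), g p ∈ fccStacking 1 (Real.sqrt (2 / 3))) → g (slotSite 0) = u →
      (∀ w ∈ fccSlots, ⟪w, u⟫_ℝ < 0 → e + A w ∈ X) → ∀ i ∈ starIdx, e + A (g (wPt i)) ∈ X := by
    intro g A u hg hgs hA i hi
    obtain ⟨hs, hneg⟩ := hslot g u hg hgs i hi
    exact hA _ hs hneg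
  have hPX : ∀ i ∈ starIdx, P i ∈ X := hown g₁ F₁ v₁ hg₁ hg₁s hown₁
  have hQX : ∀ j ∈ starIdx, Q j ∈ X := hown g₂ F₂ v₂ hg₂ hg₂s hown₂
  have hQP : ∀ j, Q j = e + B₁ (R (wPt j)) := fun j => by rw [hRapp]
  have hdist : ∀ a b : EuclideanSpace ℝ (Fin 3), dist (e + B₁ a) (e + B₁ b) = dist a b := by
    intro a b; rw [dist_eq_norm, dist_eq_norm, add_sub_add_left_eq_sub, ← map_sub, LinearIsometryEquiv.norm_map]
  have hclus : ∀ i ∈ starIdx, ∀ j ∈ starIdx, wPt i = R (wPt j) ∨ 1 ≤ dist (wPt i) (R (wPt j)) := by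
    intro i hi j hj
    by_cases h : P i = Q j
    · left
      rw [hQP j] at h
      exact B₁.injective (add_left_cancel h)
    · right
      have := hX _ (hPX i hi) _ (hQX j hj) h
      rwa [hQP j, hdist] at this
  -- the eleventh contact is off the ten star balls
  have hoff : ∀ (g : EuclideanSpace ℝ (Fin 3) ≃ₗᵢ[ℝ] EuclideanSpace ℝ (Fin 3))
      (A : EuclideanSpace ℝ (Fin 3) ≃ₗᵢ[ℝ] EuclideanSpace ℝ (Fin 3)) (u : EuclideanSpace ℝ (Fin 3)),
      (∀ p ∈ fccStacking 1 (Real.sqrt (2 / 3)), g p ∈ fccStacking 1 (Real.sqrt (2 / 3))) → g (slotSite 0) = u →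
      (∀ w ∈ fccSlots, ⟪w, u⟫_ℝ < 0 → y' ≠ e + A w) → ∀ i ∈ starIdx, y' ≠ e + A (g (wPt i)) := by
    intro g A u hg hgs hA i hi
    obtain ⟨hs, hneg⟩ := hslot g u hg hgs i hi
    exact hA _ hs hneg
  have hy'P : ∀ i ∈ starIdx, y' ≠ P i := hoff g₁ F₁ v₁ hg₁ hg₁s hoff₁
  have hy'Q : ∀ j ∈ starIdx, y' ≠ Q j := hoff g₂ F₂ v₂ hg₂ hg₂s hoff₂
  set y := B₁.symm (y' - e) with hy
  have hy'e : y' = e + B₁ y := by rw [hy, LinearIsometryEquiv.apply_symm_apply]; abel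
  have hyn : ‖y‖ = 1 := by
    rw [hy, LinearIsometryEquiv.norm_map, ← dist_eq_norm, dist_comm]; exact hy'd
  have hyF : ∀ i ∈ starIdx, 1 ≤ dist y (wPt i) := by
    intro i hi
    have := hX _ hy'X _ (hPX i hi) (hy'P i hi)
    rwa [hy'e, hP, hdist] at this
  have hyM : ∀ j ∈ starIdx, 1 ≤ dist y (R (wPt j)) := by
    intro j hj
    have := hX _ hy'X _ (hQX j hj) (hy'Q j hj)
    rwa [hy'e, hQP j, hdist] at this
  obtain ⟨L, hL1, hL2⟩ := coaxial_of_starPairNF hfar R y hclus hyn hyF hyM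
  -- transport the common frame by `B₁ = F₁ ∘ g₁`
  have himg : ∀ (g : EuclideanSpace ℝ (Fin 3) ≃ₗᵢ[ℝ] EuclideanSpace ℝ (Fin 3))
      (A : EuclideanSpace ℝ (Fin 3) ≃ₗᵢ[ℝ] EuclideanSpace ℝ (Fin 3)),
      (∀ p ∈ fccStacking 1 (Real.sqrt (2 / 3)), g p ∈ fccStacking 1 (Real.sqrt (2 / 3))) →
      (∀ p ∈ fccStacking 1 (Real.sqrt (2 / 3)), g.symm p ∈ fccStacking 1 (Real.sqrt (2 / 3))) →
      A '' fccStacking 1 (Real.sqrt (2 / 3)) = (g.trans A) '' fccStacking 1 (Real.sqrt (2 / 3)) := by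
    intro g A hg hg'
    rw [LinearIsometryEquiv.coe_trans, Set.image_comp]
    congr 1
    apply Set.Subset.antisymm
    · intro p hp; exact ⟨g.symm p, hg' p hp, g.apply_symm_apply p⟩
    · rintro _ ⟨p, hp, rfl⟩; exact hg p hp
  have hΛ₁ : F₁ '' fccStacking 1 (Real.sqrt (2 / 3)) = B₁ '' fccStacking 1 (Real.sqrt (2 / 3)) := himg g₁ F₁ hg₁ hg₁'
  have hΛ₂ : F₂ '' fccStacking 1 (Real.sqrt (2 / 3)) = B₁ '' (R '' fccStacking 1 (Real.sqrt (2 / 3))) := by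
    rw [himg g₂ F₂ hg₂ hg₂', ← Set.image_comp]
    exact Set.image_congr fun x _ => (hRapp x).symm
  have htr : ∀ S : Set (EuclideanSpace ℝ (Fin 3)), (L.trans B₁) '' S = B₁ '' (L '' S) := fun S => by
    rw [LinearIsometryEquiv.coe_trans, Set.image_comp]
  have haff := coaxial_of_common_frame F₁ F₂ (L.trans B₁) 0 0 ?_ ?_
  · obtain ⟨L', s₁, s₂, σ, σ', hσ, hσ', h₁, h₂⟩ := haff
    refine ⟨L', s₁, s₂, σ, σ', hσ, hσ', ?_, ?_⟩
    · simpa using h₁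
    · simpa using h₂
  · rw [htr, htr, hΛ₁]
    rcases hL1 with h | h
    · left; rw [← h]
    · right; rw [← h]
  · rw [htr, htr, hΛ₂]
    rcases hL2 with h | h
    · left; rw [← h]
    · right; rw [← h]

/-- **R39d and R39e from the one certified computation**: `StarPairFar` gives `CapPairCoaxial` and every
`DoubleStarCoaxialAt A₁ A₂`. -/
theorem capPairCoaxial_of_starPairFar (hfar : StarPairFar) : CapPairCoaxial :=
  capPairCoaxial_of_starPair (starPairCoaxial_of_far hfar)

/-- `DoubleStarCoaxialAt A₁ A₂` for all frames from `StarPairFar`. -/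
theorem doubleStarCoaxialAt_of_starPairFar (hfar : StarPairFar)
    (A₁ A₂ : EuclideanSpace ℝ (Fin 3) ≃ₗᵢ[ℝ] EuclideanSpace ℝ (Fin 3)) : DoubleStarCoaxialAt A₁ A₂ :=
  doubleStarCoaxialAt_of_starPair (starPairCoaxial_of_far hfar) A₁ A₂

end Summit.Ventures.Crystal3D.Theorems

end
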